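import Summits.CriticalPhenomena.SAWScalingLimit.Theorems.HexTight.Negative.LatticeG2False

/-!
# Ring counterexamples for crux `HexTight` (stmt-CriticalPhenomena-5423), part 5:
the ring has maximum degree two; uniqueness of self-avoiding chains; leftward chains are long

cdisprove generation 3 (2026-08-16). Second target of the ring barrier: the WEIGHTED statement
`DifferentiatedSumRule.OutwardDiveBound` (line `differentiated-sum-rule`, `stub_outwardDive`), refuted
in `Negative/OutwardDiveFalse.lean`. This file supplies the combinatorics of the ring `ring K` of
`Negative/LatticeG2Ring.lean`: the three lattice neighbours of a face (`adj_U_iff`, `adj_D_iff`); no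
ring cell has three ring neighbours (`ring_deg_two`), hence a duplicate-free chain of ring cells is
determined by its first two cells and its length (`chain_unique`) or its last cell
(`eq_of_chains_last`) — "forced progression"; real parts move by `≤ 1/2` per step (`re_var`); and a
duplicate-free chain `U(0,0), D(-1,0), …, U(0,2K)` (the LEFT way round) must pass the foot `U(-3K,1)`
of the left column (`exit_bottom_left`), so it has `≥ 14K - 1` cells (`leftward_long`).
-/

noncomputable section

open scoped BigOperators
open Classical
open Literature.Probability.LatticeModels
open Literature.Probability.RandomPlanarGeometry.SAW

namespace Summit.CriticalPhenomena.SAWScalingLimit.Cruxes.HexTight.Negative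

/-! ## Neighbours of a face; the ring has maximum degree two -/

/-- a down face as a pair -/
theorem D_eq_iff {y : Site 2} {a b : ℤ} : ((y, (1 : Fin 2)) : HexVertex) = D a b ↔ y = ![a, b] := by
  simp [D, Prod.ext_iff]

/-- an up face as a pair -/
theorem U_eq_iff {y : Site 2} {a b : ℤ} : ((y, (0 : Fin 2)) : HexVertex) = U a b ↔ y = ![a, b] := by
  simp [U, Prod.ext_iff]

/-- **the three neighbours of an up face** -/
theorem adj_U_iff {i j : ℤ} {v : HexVertex} :
    hexGraph.Adj (U i j) v ↔ v = D i j ∨ v = D (i - 1) j ∨ v = D i (j - 1) := by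
  obtain ⟨y, l⟩ := v
  fin_cases l
  · simp only [Fin.zero_eta]
    constructor
    · intro h; exact absurd h (not_hexGraph_adj_of_snd_eq_holds _ _ rfl)
    · rintro (h | h | h) <;> exact absurd (congrArg Prod.snd h) (by simp [D])
  · simp only [Fin.mk_one]
    rw [U, hexGraph_adj_iff_of_snd_eq_zero_holds, D_eq_iff, D_eq_iff, D_eq_iff, single0_eq, single1_eq,
      vec_sub, vec_sub, sub_zero, sub_zero]

/-- **the three neighbours of a down face** -/
theorem adj_D_iff {i j : ℤ} {v : HexVertex} :
    hexGraph.Adj (D i j) v ↔ v = U i j ∨ v = U (i + 1) j ∨ v = U i (j + 1) := by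
  obtain ⟨y, l⟩ := v
  fin_cases l
  · simp only [Fin.zero_eta]
    rw [D, hexGraph_adj_iff_of_snd_eq_one, U_eq_iff, U_eq_iff, U_eq_iff, single0_eq, single1_eq,
      vec_add, vec_add, add_zero, add_zero]
  · simp only [Fin.mk_one]
    constructor
    · intro h; exact absurd h (not_hexGraph_adj_of_snd_eq_holds _ _ rfl)
    · rintro (h | h | h) <;> exact absurd (congrArg Prod.snd h) (by simp [U])

/-- three pairwise distinct values taken from `{n₁, n₂, n₃}` exhaust it -/
theorem three_cover {α : Type*} {n₁ n₂ n₃ a b c : α} (P : α → Prop)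
    (ha : a = n₁ ∨ a = n₂ ∨ a = n₃) (hb : b = n₁ ∨ b = n₂ ∨ b = n₃) (hc : c = n₁ ∨ c = n₂ ∨ c = n₃)
    (hab : a ≠ b) (hac : a ≠ c) (hbc : b ≠ c) (hPa : P a) (hPb : P b) (hPc : P c) :
    P n₁ ∧ P n₂ ∧ P n₃ := by
  rcases ha with rfl | rfl | rfl <;> rcases hb with rfl | rfl | rfl <;>
    rcases hc with rfl | rfl | rfl <;> simp_all

/-- **The ring has maximum degree two**: no ring cell has three pairwise distinct ring neighbours
(in each case one of the three lattice neighbours lies off the ring). -/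
theorem ring_deg_two {K : ℕ} (hK : 1 ≤ K) {y a b c : HexVertex} (hy : y ∈ ring K)
    (ha : hexGraph.Adj y a) (hb : hexGraph.Adj y b) (hc : hexGraph.Adj y c)
    (hab : a ≠ b) (hac : a ≠ c) (hbc : b ≠ c)
    (haR : a ∈ ring K) (hbR : b ∈ ring K) (hcR : c ∈ ring K) : False := by
  rcases face_eq y with hyU | hyD
  · have hy' : U (y.1 0) (y.1 1) ∈ ring K := hyU ▸ hy
    have ha' : hexGraph.Adj (U (y.1 0) (y.1 1)) a := hyU ▸ ha
    have hb' : hexGraph.Adj (U (y.1 0) (y.1 1)) b := hyU ▸ hb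
    have hc' : hexGraph.Adj (U (y.1 0) (y.1 1)) c := hyU ▸ hc
    obtain ⟨h1, h2, h3⟩ := three_cover (fun v => v ∈ ring K) (adj_U_iff.1 ha') (adj_U_iff.1 hb')
      (adj_U_iff.1 hc') hab hac hbc haR hbR hcR
    rw [D_mem_ring] at h1 h2 h3
    rw [U_mem_ring] at hy'
    omega
  · have hy' : D (y.1 0) (y.1 1) ∈ ring K := hyD ▸ hy
    have ha' : hexGraph.Adj (D (y.1 0) (y.1 1)) a := hyD ▸ ha
    have hb' : hexGraph.Adj (D (y.1 0) (y.1 1)) b := hyD ▸ hb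
    have hc' : hexGraph.Adj (D (y.1 0) (y.1 1)) c := hyD ▸ hc
    obtain ⟨h1, h2, h3⟩ := three_cover (fun v => v ∈ ring K) (adj_D_iff.1 ha') (adj_D_iff.1 hb')
      (adj_D_iff.1 hc') hab hac hbc haR hbR hcR
    rw [U_mem_ring] at h1 h2 h3
    rw [D_mem_ring] at hy'
    omega

/-! ## Uniqueness of self-avoiding chains in the ring -/

/-- **Forced progression.** Two duplicate-free chains of ring cells with the same first two cells
and the same length coincide (after the first step there is never a choice: the cell has at most
two ring neighbours and one of them is the predecessor). -/
theorem chain_unique {K : ℕ} (hK : 1 ≤ K) : ∀ (t₁ : List HexVertex) (v n : HexVertex)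
    (t₂ : List HexVertex),
    (v :: n :: t₁).IsChain hexGraph.Adj → (v :: n :: t₂).IsChain hexGraph.Adj →
    (v :: n :: t₁).Nodup → (v :: n :: t₂).Nodup →
    (∀ y ∈ v :: n :: t₁, y ∈ ring K) → (∀ y ∈ v :: n :: t₂, y ∈ ring K) →
    t₁.length = t₂.length → t₁ = t₂
  | [], v, n, t₂, _, _, _, _, _, _, hl => by
    rw [List.length_nil, eq_comm, List.length_eq_zero_iff] at hl
    exact hl.symm
  | a :: t₁, v, n, [], _, _, _, _, _, _, hl => by simp at hl
  | a :: t₁, v, n, b :: t₂, hc₁, hc₂, hn₁, hn₂, hr₁, hr₂, hl => by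
    rw [List.isChain_cons_cons] at hc₁ hc₂
    have hna : hexGraph.Adj n a := (List.isChain_cons_cons.1 hc₁.2).1
    have hnb : hexGraph.Adj n b := (List.isChain_cons_cons.1 hc₂.2).1
    have hnv : hexGraph.Adj n v := hc₁.1.symm
    have hva : v ≠ a := fun h => (List.nodup_cons.1 hn₁).1 (by rw [h]; simp)
    have hvb : v ≠ b := fun h => (List.nodup_cons.1 hn₂).1 (by rw [h]; simp)
    have hab : a = b := by
      by_contra hab
      exact ring_deg_two hK (hr₁ n (by simp)) hnv hna hnb hva hvb hab (hr₁ v (by simp))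
        (hr₁ a (by simp)) (hr₂ b (by simp))
    subst hab
    rw [chain_unique hK t₁ n a t₂ hc₁.2 hc₂.2 (List.nodup_cons.1 hn₁).2 (List.nodup_cons.1 hn₂).2
      (fun y hy => hr₁ y (List.mem_cons_of_mem _ hy)) (fun y hy => hr₂ y (List.mem_cons_of_mem _ hy))
      (by simpa using hl)]

/-- The shorter of two duplicate-free ring chains with the same first two cells is a prefix of
the longer. -/
theorem prefix_of_chains {K : ℕ} (hK : 1 ≤ K) {v n : HexVertex} {t₁ t₂ : List HexVertex}
    (hc₁ : (v :: n :: t₁).IsChain hexGraph.Adj) (hc₂ : (v :: n :: t₂).IsChain hexGraph.Adj)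
    (hn₁ : (v :: n :: t₁).Nodup) (hn₂ : (v :: n :: t₂).Nodup)
    (hr₁ : ∀ y ∈ v :: n :: t₁, y ∈ ring K) (hr₂ : ∀ y ∈ v :: n :: t₂, y ∈ ring K)
    (hl : t₁.length ≤ t₂.length) : (v :: n :: t₁) <+: (v :: n :: t₂) := by
  have htake : v :: n :: t₂.take t₁.length = (v :: n :: t₂).take (t₁.length + 2) := by simp
  have key := chain_unique hK t₁ v n (t₂.take t₁.length) hc₁ (by rw [htake]; exact hc₂.take _) hn₁
    (by rw [htake]; exact hn₂.sublist (List.take_sublist _ _)) hr₁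
    (fun y hy => hr₂ y (by rw [htake] at hy; exact List.mem_of_mem_take hy))
    (by rw [List.length_take]; omega)
  rw [key]
  exact List.cons_prefix_cons.2 ⟨rfl, List.cons_prefix_cons.2 ⟨rfl, List.take_prefix _ _⟩⟩

/-- **Two duplicate-free ring chains with the same first two cells and the same last cell are
equal.** -/
theorem eq_of_chains_last {K : ℕ} (hK : 1 ≤ K) {v n : HexVertex} {t₁ t₂ : List HexVertex}
    (hc₁ : (v :: n :: t₁).IsChain hexGraph.Adj) (hc₂ : (v :: n :: t₂).IsChain hexGraph.Adj)
    (hn₁ : (v :: n :: t₁).Nodup) (hn₂ : (v :: n :: t₂).Nodup)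
    (hr₁ : ∀ y ∈ v :: n :: t₁, y ∈ ring K) (hr₂ : ∀ y ∈ v :: n :: t₂, y ∈ ring K)
    (hlast : (v :: n :: t₁).getLast (List.cons_ne_nil _ _) =
      (v :: n :: t₂).getLast (List.cons_ne_nil _ _)) : t₁ = t₂ := by
  -- the shorter is a prefix of the longer; a proper prefix would repeat the common last cell
  have key : ∀ {s₁ s₂ : List HexVertex}, (v :: n :: s₁) <+: (v :: n :: s₂) → (v :: n :: s₂).Nodup →
      (v :: n :: s₁).getLast (List.cons_ne_nil _ _) = (v :: n :: s₂).getLast (List.cons_ne_nil _ _) →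
      s₁ = s₂ := by
    intro s₁ s₂ hpre hnd hl
    obtain ⟨s, hs⟩ := hpre
    rcases eq_or_ne s [] with rfl | hs0
    · simpa using hs
    · exfalso
      have hmem₁ : (v :: n :: s₁).getLast (List.cons_ne_nil _ _) ∈ v :: n :: s₁ := List.getLast_mem _
      have hmem₂ : (v :: n :: s₂).getLast (List.cons_ne_nil _ _) ∈ s := by
        have : (v :: n :: s₂).getLast (List.cons_ne_nil _ _) = s.getLast hs0 := by
          have h1 : (v :: n :: s₂).getLast? = some (s.getLast hs0) := by
            rw [← hs, List.getLast?_append, List.getLast?_eq_some_getLast hs0, Option.some_or]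
          rw [List.getLast?_eq_some_getLast (List.cons_ne_nil _ _)] at h1
          exact Option.some.inj h1
        rw [this]; exact List.getLast_mem hs0
      rw [← hs] at hnd
      exact List.disjoint_of_nodup_append hnd hmem₁ (hl ▸ hmem₂)
  rcases le_total t₁.length t₂.length with h | h
  · exact key (prefix_of_chains hK hc₁ hc₂ hn₁ hn₂ hr₁ hr₂ h) hn₂ hlast
  · exact (key (prefix_of_chains hK hc₂ hc₁ hn₂ hn₁ hr₂ hr₁ h) hn₁ hlast.symm).symm

/-! ## Real parts vary slowly along a chain; leftward chains to `U(0,2K)` are long -/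

/-- Along a lattice chain with `m` steps the real part moves by at most `m/2`. -/
theorem re_var : ∀ (a : HexVertex) (l : List HexVertex), (a :: l).IsChain hexGraph.Adj →
    |(hexCenter ((a :: l).getLast (List.cons_ne_nil _ _))).re - (hexCenter a).re| ≤ l.length / 2
  | a, [], _ => by simp
  | a, b :: l, h => by
    rw [List.isChain_cons_cons] at h
    have ih := re_var b l h.2
    have hab := (re_sub_re_of_adj h.1).1
    rw [List.getLast_cons (List.cons_ne_nil _ _)]
    simp only [List.length_cons]
    push_cast
    rw [abs_le] at ih hab ⊢
    constructor <;> linarith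

/-- **Exits from the bottom-left row.** A ring neighbour of a bottom-left cell (`j = 0`, real part
`< Re x`) is bottom-left, or the centre `U(0,0)`, or the foot `U(-3K,1)` of the left column. -/
theorem exit_bottom_left {K : ℕ} (hK : 1 ≤ K) {f e : HexVertex} (hf : f ∈ ring K) (hf0 : f.1 1 = 0)
    (hfre : (hexCenter f).re < x₀.re) (he : e ∈ ring K) (hfe : hexGraph.Adj f e) :
    (e.1 1 = 0 ∧ (hexCenter e).re < x₀.re) ∨ e = U 0 0 ∨ e = U (-(3 * K : ℤ)) 1 := by
  rw [x₀_re] at hfre ⊢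
  rcases face_eq f with hfU | hfD
  · rw [hf0] at hfU
    have hf' : U (f.1 0) 0 ∈ ring K := hfU ▸ hf
    have hfe' : hexGraph.Adj (U (f.1 0) 0) e := hfU ▸ hfe
    have hfre' : (hexCenter (U (f.1 0) 0)).re < 1 / 2 := hfU ▸ hfre
    rw [re_U] at hfre'
    have hi : f.1 0 ≤ -1 := by
      by_contra h
      have : (0 : ℝ) ≤ f.1 0 := by exact_mod_cast (show (0 : ℤ) ≤ f.1 0 by omega)
      push_cast at hfre'; linarith
    have hi' : (f.1 0 : ℝ) ≤ -1 := by exact_mod_cast hi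
    rw [U_mem_ring] at hf'
    rcases adj_U_iff.1 hfe' with rfl | rfl | rfl
    · left
      exact ⟨rfl, by rw [re_D]; push_cast; linarith⟩
    · left
      exact ⟨rfl, by rw [re_D]; push_cast; linarith⟩
    · exfalso
      rw [D_mem_ring] at he
      omega
  · rw [hf0] at hfD
    have hf' : D (f.1 0) 0 ∈ ring K := hfD ▸ hf
    have hfe' : hexGraph.Adj (D (f.1 0) 0) e := hfD ▸ hfe
    have hfre' : (hexCenter (D (f.1 0) 0)).re < 1 / 2 := hfD ▸ hfre
    rw [re_D] at hfre'
    have hi : f.1 0 ≤ -1 := by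
      by_contra h
      have : (0 : ℝ) ≤ f.1 0 := by exact_mod_cast (show (0 : ℤ) ≤ f.1 0 by omega)
      push_cast at hfre'; linarith
    have hi' : (f.1 0 : ℝ) ≤ -1 := by exact_mod_cast hi
    rw [D_mem_ring] at hf'
    rcases adj_D_iff.1 hfe' with rfl | rfl | rfl
    · left
      rw [U_mem_ring] at he
      exact ⟨rfl, by rw [re_U]; push_cast; linarith⟩
    · rcases lt_or_eq_of_le hi with hi'' | hi''
      · left
        have : (f.1 0 : ℝ) + 1 ≤ -1 := by exact_mod_cast (show f.1 0 + 1 ≤ -1 by omega)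
        exact ⟨rfl, by rw [re_U]; push_cast; linarith⟩
      · right; left
        rw [hi'']; rfl
    · right; right
      rw [U_mem_ring] at he
      have : f.1 0 = -(3 * K : ℤ) := by omega
      rw [this]; rfl

/-- **Leftward chains are long.** A duplicate-free chain of ring cells `U(0,0), D(-1,0), …` ending
at `U(0,2K)` passes through the foot `U(-3K,1)` of the left column, and real parts move by `≤ 1/2`
per step: it has at least `14K - 1` cells. -/
theorem leftward_long {K : ℕ} (hK : 1 ≤ K) {t : List HexVertex}
    (hc : (U 0 0 :: D (-1) 0 :: t).IsChain hexGraph.Adj) (hn : (U 0 0 :: D (-1) 0 :: t).Nodup)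
    (hr : ∀ y ∈ U 0 0 :: D (-1) 0 :: t, y ∈ ring K)
    (hlast : (U 0 0 :: D (-1) 0 :: t).getLast (List.cons_ne_nil _ _) = U 0 (2 * K)) :
    14 * K ≤ t.length + 3 := by
  have hcc : (D (-1) 0 :: t).IsChain hexGraph.Adj := (List.isChain_cons_cons.1 hc).2
  have hv₀ : U 0 0 ∉ D (-1) 0 :: t := (List.nodup_cons.1 hn).1
  have hcr : ∀ y ∈ D (-1) 0 :: t, y ∈ ring K := fun y hy => hr y (List.mem_cons_of_mem _ hy)
  have hclast : (D (-1) 0 :: t).getLast (List.cons_ne_nil _ _) = U 0 (2 * K) :=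
    (List.getLast_cons (List.cons_ne_nil _ _)).symm.trans hlast
  have h2K : (U 0 (2 * (K : ℤ))).1 1 = 2 * K := rfl
  -- the first exit from the bottom-left row is at the foot of the left column
  set B : HexVertex → Bool := fun y => decide (y.1 1 = 0 ∧ (hexCenter y).re < x₀.re) with hB
  set p := (D (-1) 0 :: t).takeWhile B with hp
  set q := (D (-1) 0 :: t).dropWhile B with hq
  have hpq : p ++ q = D (-1) 0 :: t := List.takeWhile_append_dropWhile
  have hq_ne : q ≠ [] := by
    intro hq0
    have hall := (List.dropWhile_eq_nil_iff.1 hq0) _ (List.getLast_mem (List.cons_ne_nil (D (-1) 0) t))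
    rw [hclast] at hall
    have h' : (U 0 (2 * (K : ℤ))).1 1 = 0 ∧ (hexCenter (U 0 (2 * (K : ℤ)))).re < x₀.re := by
      simpa [hB] using hall
    have h'' := h'.1
    rw [h2K] at h''
    omega
  obtain ⟨e, q', he⟩ := List.exists_cons_of_ne_nil hq_ne
  have he_not : ¬ (e.1 1 = 0 ∧ (hexCenter e).re < x₀.re) := by
    have := dropWhile_eq_cons_imp (hq.symm.trans he).symm
    simpa [hB] using this
  have hp_ne : p ≠ [] := by
    intro hp0
    rw [hp0, List.nil_append] at hpq
    have h1 := congrArg List.head? hpq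
    rw [he] at h1
    have hed : e = D (-1) 0 := by simpa using h1
    apply he_not
    rw [hed]
    exact ⟨rfl, by rw [x₀_re, re_D]; norm_num⟩
  have hfe : hexGraph.Adj (p.getLast hp_ne) e := by
    have hch := hcc
    rw [← hpq, List.isChain_append] at hch
    exact hch.2.2 _ (List.getLast?_eq_some_getLast hp_ne) _ (by rw [he]; rfl)
  have hf : (p.getLast hp_ne).1 1 = 0 ∧ (hexCenter (p.getLast hp_ne)).re < x₀.re := by
    have := List.mem_takeWhile_imp (p := B) (List.getLast_mem hp_ne)
    simpa [hB] using this
  have he_mem : e ∈ D (-1) 0 :: t := by rw [← hpq, he]; simp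
  have he_ring : e ∈ ring K := hcr e he_mem
  have hf_ring : p.getLast hp_ne ∈ ring K :=
    hcr _ (by rw [← hpq]; exact List.mem_append_left _ (List.getLast_mem hp_ne))
  have he_eq : e = U (-(3 * K : ℤ)) 1 := by
    rcases exit_bottom_left hK hf_ring hf.1 hf.2 he_ring hfe with h | h | h
    · exact absurd h he_not
    · exact absurd (h ▸ he_mem) hv₀
    · exact h
  -- split the chain at the foot; the first piece starts with `D(-1,0)`
  obtain ⟨s, s', hsplit⟩ := List.append_of_mem he_mem
  rw [he_eq] at hsplit
  obtain ⟨s₀, hs⟩ : ∃ s₀, s = D (-1) 0 :: s₀ := by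
    rcases s with _ | ⟨d, s₀⟩
    · rw [List.nil_append] at hsplit
      exact absurd (List.cons.inj hsplit).1.symm (U_ne_D _ _ _ _)
    · rw [List.cons_append] at hsplit
      exact ⟨s₀, by rw [(List.cons.inj hsplit).1]⟩
  rw [hs, List.cons_append] at hsplit
  have ht : t = s₀ ++ U (-(3 * K : ℤ)) 1 :: s' := (List.cons.inj hsplit).2
  -- the two pieces are chains
  have hch : ((D (-1) 0 :: s₀) ++ (U (-(3 * K : ℤ)) 1 :: s')).IsChain hexGraph.Adj := by
    rw [List.cons_append, ← ht]; exact hcc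
  obtain ⟨hchA, hchB, hlink⟩ := List.isChain_append.1 hch
  have h1 : ((D (-1) 0 :: s₀) ++ [U (-(3 * K : ℤ)) 1]).IsChain hexGraph.Adj :=
    List.isChain_append.2 ⟨hchA, List.isChain_singleton _, fun x hx y hy => hlink x hx y (by
      simp only [List.head?_cons, Option.mem_def, Option.some.injEq] at hy ⊢; exact hy)⟩
  rw [List.cons_append] at h1
  have hv1 := re_var (D (-1) 0) (s₀ ++ [U (-(3 * K : ℤ)) 1]) h1
  have hv2 := re_var (U (-(3 * K : ℤ)) 1) s' hchB
  have hl1 : (D (-1) 0 :: (s₀ ++ [U (-(3 * K : ℤ)) 1])).getLast (List.cons_ne_nil _ _) =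
      U (-(3 * K : ℤ)) 1 := by simp
  have hl2 : (U (-(3 * K : ℤ)) 1 :: s').getLast (List.cons_ne_nil _ _) = U 0 (2 * K) := by
    have h3 : (D (-1) 0 :: t).getLast? = some (U 0 (2 * K)) := by
      rw [List.getLast?_eq_some_getLast (List.cons_ne_nil _ _)]; exact congrArg some hclast
    rw [hsplit, ← List.cons_append, List.getLast?_append,
      List.getLast?_eq_some_getLast (List.cons_ne_nil _ _), Option.some_or] at h3
    exact Option.some.inj h3
  rw [hl1, re_U, re_D] at hv1
  rw [hl2, re_U, re_U] at hv2
  simp only [List.length_append, List.length_cons, List.length_nil] at hv1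
  push_cast at hv1 hv2
  rw [abs_le] at hv1 hv2
  have hK1 : (1 : ℝ) ≤ K := by exact_mod_cast hK
  have hlen : t.length = s₀.length + 1 + s'.length := by
    rw [ht]; simp only [List.length_append, List.length_cons]; omega
  have h1' : (6 * K : ℝ) - 2 ≤ s₀.length + 1 := by linarith [hv1.1, hv1.2]
  have h2' : (8 * K : ℝ) - 1 ≤ s'.length := by linarith [hv2.1, hv2.2]
  have : (14 * K : ℝ) ≤ t.length + 3 := by rw [hlen]; push_cast; linarith
  exact_mod_cast this



end Summit.CriticalPhenomena.SAWScalingLimit.Cruxes.HexTight.Negative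

end
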